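import Literature.NumberTheory.IwasawaTheory.ImaginaryQuadraticTwoTowerDyadicPrime
import Literature.NumberTheory.IwasawaTheory.ImaginaryQuadraticTwoTowerRootsOfUnityEven
import Literature.NumberTheory.NumberFields.CMFieldQuadraticLayerCapitulationKernel
import HarnessLib

/-!
# Capitulation in the cyclotomic `ℤ₂`-tower of `ℚ(√−d)`, `d ≡ 1 (mod 4)`: the kernel of `Cl(X_{n+1}) → Cl(X_{n+2})` is `{1, [𝔓_{n+1}]}` and the dyadic class
# `[𝔓_{n+2}]` is not an extended class (proved; no definition, no named fact)

Topic `NumberTheory/IwasawaTheory` (namespace = path).  THEOREM-ONLY file, written by the prover seat `bsd-line-att-p3` g32 (cell `bsd-f1-sign2`; `--supports`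
stmt-BirchSwinnertonDyer-22298; closes nothing).  Assembles `NumberFields/CMFieldQuadraticLayerCapitulationKernel` (abstract: capitulation kernel `⊆ {1, [w₀]}` and
`[W₀]` not extended, for a quadratic CM layer with one exceptional ramified prime), `ImaginaryQuadraticTwoTowerDyadicPrime` (the dyadic primes `𝔓_m` of
`X_m = e(K)·ℚ_m`: unique, `e(𝔓_m ∣ 2) = 2^{m+1}`, `e(𝔓_m ∣ X_m⁺) = 2`, `[𝔓_m]² = 1`) and `ImaginaryQuadraticTwoTowerRootsOfUnityEven` ((W) for `d ≡ 1 (mod 4)`), for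
`K ∋ √−d`, `d ≡ 1 (mod 4)` squarefree, `d ≠ 1` — the `2`-RAMIFIED case of Ferrero 1980 / Kida 1979, where capitulation of order `2` occurs at every layer.

* §1 `ram_fieldRange_sup_layer_pair_of_ne` — (RAM′): for a prime `w ≠ 𝔓_{n+1}` of `X_{n+1}` ramified over `X_{n+1}⁺` and every `W ∣ w` of `X_{n+2}`: `e(W ∣ w) = 1`,
  `e(W ∣ W ∩ X_{n+2}⁺) = e(w ∣ w ∩ X_{n+1}⁺)` (the tree's (RAM) proof, g31, which only uses that `w` lies over an ODD prime factor of `d_K`).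
* §2 ★ `dyadicCapitulation_fieldRange_sup_layer` — for `M = X_{n+1} ⊆ L = X_{n+2}` and their dyadic primes `𝔓_M`, `𝔓_L`:
  **(i) `i_{L/M}(c) = 1 ⟹ c ∈ {1, [𝔓_M]}`; (ii) `[𝔓_L] ∉ i_{L/M}(Cl(M))`; (iii) `i_{L/M}[𝔓_M] = [𝔓_L]² = 1`** — so `ker i_{L/M} = {1, [𝔓_M]}` has order `2`
  (`[𝔓_M] ≠ 1` by (ii) one level down) and the induced map `Cl(M)/⟨[𝔓_M]⟩ → Cl(L)/⟨[𝔓_L]⟩` is injective.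

References: [Ferrero1980AJM] §3; [Kida1979Tohoku] Thm. 1; [Schettler2014] Thm. 8 (`|H¹(G,P_L)| = 1`, `|H²(G,P_L)| = 2`); [Washington1997] §13.1, Prop. 13.26.
-/

set_option autoImplicit false

noncomputable section

open scoped NumberField nonZeroDivisors
open NumberField NumberField.IsCMField IsDedekindDomain Field IntermediateField Module Ideal

namespace Literature.NumberTheory.IwasawaTheory

open Literature.NumberTheory.EllipticCurves Literature.NumberTheory.EllipticCurves.ZpExtension
  Literature.NumberTheory.GaloisRepresentations Literature.NumberTheory.NumberFields Literature.NumberTheory.NumberFields.CMLayer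

/-! ## §0 Degrees along an inclusion of intermediate fields -/

section Degree

variable {F E : Type*} [Field F] [Field E] [Algebra F E]

/-- **Tower law along an inclusion of intermediate fields**: for `A ≤ B` with the inclusion algebra structure, `[B : A]·[A : F] = [B : F]`. [folklore]
[cite: NeukirchANT1999, Ch. I §2 (degree of a tower of field extensions)] -/
theorem finrank_inclusion_mul_finrank (A B : IntermediateField F E) (h : A ≤ B) :
    letI : Algebra ↥A ↥B := (IntermediateField.inclusion h).toRingHom.toAlgebra
    Module.finrank ↥A ↥B * Module.finrank F ↥A = Module.finrank F ↥B := by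
  letI : Algebra ↥A ↥B := (IntermediateField.inclusion h).toRingHom.toAlgebra
  haveI : IsScalarTower F ↥A ↥B := IsScalarTower.of_algebraMap_eq fun _ => rfl
  rw [mul_comm]
  exact Module.finrank_mul_finrank F ↥A ↥B

end Degree

/-! ## §1 (RAM′) for the pair `X_{n+1} ⊆ X_{n+2}`, off the dyadic prime -/

section Ram

variable {κ : ZpExtension ℚ 2} (hκ : κ.IsCyclotomic) (K : Type) [Field K] [NumberField K] (hK : IsImaginaryQuadratic K)
  (j : K →ₐ[ℚ] AlgebraicClosure ℚ)

include hκ hK in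
/-- **(RAM′) for `X_{n+1} ⊆ X_{n+2}` off the dyadic prime**: if a prime `w ≠ w₀` of `X_{n+1}` (`w₀` the unique prime above `2`) is ramified over `X_{n+1}⁺` (so lies over an ODD prime factor `q` of `d_K`), then for every prime `W` of
`X_{n+2}` above `w`: `e(W ∣ w) = 1` and `e(W ∣ W ∩ X_{n+2}⁺) = e(w ∣ w ∩ X_{n+1}⁺)` (`= 2`): `X_{n+2}⁺ ≅ ℚ_{n+2}` is unramified at `q`, `e ≤ 2` in `X/X⁺`, and
`e(W ∣ q) = e(W ∣ w)·e(w ∣ v)·e(v ∣ q)`. [cite: Ferrero1980AJM, §2] [cite: Washington1997, §13.1] [cite: NeukirchANT1999, Ch. I §9 Prop. (9.6)] -/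
theorem ram_fieldRange_sup_layer_pair_of_ne (n : ℕ) :
    haveI : NumberField ↥(j.fieldRange ⊔ κ.layer (n + 1)) := numberField_fieldRange_sup_layer κ K j (n + 1)
    haveI : NumberField ↥(j.fieldRange ⊔ κ.layer (n + 2)) := numberField_fieldRange_sup_layer κ K j (n + 2)
    letI : Algebra ↥(j.fieldRange ⊔ κ.layer (n + 1)) ↥(j.fieldRange ⊔ κ.layer (n + 2)) :=
      (IntermediateField.inclusion (sup_le_sup_left (κ.layer_mono (by omega)) _)).toRingHom.toAlgebra
    ∀ [IsCMField ↥(j.fieldRange ⊔ κ.layer (n + 1))] [IsCMField ↥(j.fieldRange ⊔ κ.layer (n + 2))],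
    ∀ w₀ : HeightOneSpectrum (𝓞 ↥(j.fieldRange ⊔ κ.layer (n + 1))),
      (∀ w' : HeightOneSpectrum (𝓞 ↥(j.fieldRange ⊔ κ.layer (n + 1))), (2 : 𝓞 ↥(j.fieldRange ⊔ κ.layer (n + 1))) ∈ w'.asIdeal → w' = w₀) →
    ∀ w : HeightOneSpectrum (𝓞 ↥(j.fieldRange ⊔ κ.layer (n + 1))), w ≠ w₀ →
      w.asIdeal.ramificationIdx (𝓞 ↥(maximalRealSubfield ↥(j.fieldRange ⊔ κ.layer (n + 1)))) ≠ 1 →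
      ∀ W : HeightOneSpectrum (𝓞 ↥(j.fieldRange ⊔ κ.layer (n + 2))), W.under (𝓞 ↥(j.fieldRange ⊔ κ.layer (n + 1))) = w →
        W.asIdeal.ramificationIdx (𝓞 ↥(j.fieldRange ⊔ κ.layer (n + 1))) = 1 ∧
          W.asIdeal.ramificationIdx (𝓞 ↥(maximalRealSubfield ↥(j.fieldRange ⊔ κ.layer (n + 2)))) =
            w.asIdeal.ramificationIdx (𝓞 ↥(maximalRealSubfield ↥(j.fieldRange ⊔ κ.layer (n + 1)))) := by
  intro _instM _instL w₀ hw₀ w hww₀ hw W hW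
  set M := ↥(j.fieldRange ⊔ κ.layer (n + 1))
  set L := ↥(j.fieldRange ⊔ κ.layer (n + 2))
  haveI : NumberField M := numberField_fieldRange_sup_layer κ K j (n + 1)
  haveI : NumberField L := numberField_fieldRange_sup_layer κ K j (n + 2)
  have hML : j.fieldRange ⊔ κ.layer (n + 1) ≤ j.fieldRange ⊔ κ.layer (n + 2) := sup_le_sup_left (κ.layer_mono (by omega)) _
  letI : Algebra M L := (IntermediateField.inclusion hML).toRingHom.toAlgebra
  obtain ⟨_, _, hrestM⟩ := isCMField_fieldRange_sup_layer hκ K hK j (n + 1)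
  obtain ⟨_, _, hrestL⟩ := isCMField_fieldRange_sup_layer hκ K hK j (n + 2)
  obtain ⟨-, -, hdiscM, hgenM⟩ := hrestM
  obtain ⟨-, -, hdiscL, -⟩ := hrestL
  -- `K`-algebra structure on `M` through `j`
  let eK : K →+* M := (j : K →+* AlgebraicClosure ℚ).codRestrict (j.fieldRange ⊔ κ.layer (n + 1)) fun x =>
    (le_sup_left : j.fieldRange ≤ j.fieldRange ⊔ κ.layer (n + 1)) (j.mem_fieldRange.mpr ⟨x, rfl⟩)
  letI algK : Algebra K M := eK.toAlgebra
  haveI : Module.Free ℚ K := Module.Free.of_divisionRing _ _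
  haveI : Algebra.IsQuadraticExtension ℚ K := { finrank_eq_two' := hK.1 }
  haveI : IsGalois ℚ K := Algebra.IsQuadraticExtension.isGalois ℚ K
  -- the prime `v` of `M⁺` under `w` is ramified in `M`, hence over an odd prime factor `q` of `d_K`
  set v := w.under (𝓞 ↥(maximalRealSubfield M)) with hv
  haveI := w.isPrime
  haveI := W.isPrime
  haveI : w.asIdeal.LiesOver v.asIdeal := ⟨rfl⟩
  have hvram : v.asIdeal.ramificationIdxIn (𝓞 M) ≠ 1 := by
    rwa [Ideal.ramificationIdxIn_eq_ramificationIdx v.asIdeal w.asIdeal (M ≃ₐ[↥(maximalRealSubfield M)] M)]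
  obtain ⟨q, hq, hqd, hvq⟩ := exists_dvd_discr_of_ramificationIdxIn_ne_one M K hgenM v hvram
  haveI := hvq
  have hq2 : q ≠ 2 := by
    rintro rfl
    haveI hw2 : w.asIdeal.LiesOver (Ideal.span {((2 : ℕ) : ℤ)}) := Ideal.LiesOver.trans w.asIdeal v.asIdeal _
    apply hww₀
    apply hw₀
    have h := Ideal.mem_span_singleton_self ((2 : ℕ) : ℤ)
    rw [hw2.over, Ideal.under_def, Ideal.mem_comap, map_natCast] at h
    exact_mod_cast h
  -- primes: `W ∩ L⁺ = 𝔮`, `W ∩ M = w`, `w ∩ M⁺ = v`, all over `q`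
  set 𝔮 := W.under (𝓞 ↥(maximalRealSubfield L)) with h𝔮
  haveI : W.asIdeal.LiesOver 𝔮.asIdeal := ⟨rfl⟩
  haveI : W.asIdeal.LiesOver w.asIdeal := ⟨by rw [← hW]; rfl⟩
  haveI hwq : w.asIdeal.LiesOver (Ideal.span {(q : ℤ)}) := Ideal.LiesOver.trans w.asIdeal v.asIdeal _
  haveI hWq : W.asIdeal.LiesOver (Ideal.span {(q : ℤ)}) := Ideal.LiesOver.trans W.asIdeal w.asIdeal _
  haveI h𝔮q : 𝔮.asIdeal.LiesOver (Ideal.span {(q : ℤ)}) := Ideal.LiesOver.tower_bot W.asIdeal 𝔮.asIdeal _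
  -- `e(𝔮 ∣ q) = 1`
  have hq' : Prime (q : ℤ) := Nat.prime_iff_prime_int.mp hq
  have he𝔮 : 𝔮.asIdeal.ramificationIdx ℤ = 1 := by
    have hunr := (NumberField.not_dvd_discr_iff_isUnramifiedIn ↥(maximalRealSubfield L) (𝓞 ↥(maximalRealSubfield L)) hq').mp (hdiscL q hq hq2)
    haveI : (Ideal.span {(q : ℤ)}).IsMaximal := by
      haveI : Fact q.Prime := ⟨hq⟩; exact Int.ideal_span_isMaximal_of_prime q
    haveI := 𝔮.isPrime
    exact (Algebra.isUnramifiedIn_iff_forall_ramificationIdx_eq_one.mp hunr) 𝔮.asIdeal h𝔮q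
  -- the towers
  have h1 : W.asIdeal.ramificationIdx ℤ = 𝔮.asIdeal.ramificationIdx ℤ * W.asIdeal.ramificationIdx (𝓞 ↥(maximalRealSubfield L)) :=
    Ideal.ramificationIdx_tower (R := ℤ) (S := 𝓞 ↥(maximalRealSubfield L)) (T := 𝓞 L) (q := 𝔮.asIdeal) (r := W.asIdeal)
  have h2 : W.asIdeal.ramificationIdx ℤ = w.asIdeal.ramificationIdx ℤ * W.asIdeal.ramificationIdx (𝓞 M) :=
    Ideal.ramificationIdx_tower (R := ℤ) (S := 𝓞 M) (T := 𝓞 L) (q := w.asIdeal) (r := W.asIdeal)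
  have h3 : w.asIdeal.ramificationIdx ℤ = v.asIdeal.ramificationIdx ℤ * w.asIdeal.ramificationIdx (𝓞 ↥(maximalRealSubfield M)) :=
    Ideal.ramificationIdx_tower (R := ℤ) (S := 𝓞 ↥(maximalRealSubfield M)) (T := 𝓞 M) (q := v.asIdeal) (r := w.asIdeal)
  have hle2 := ramificationIdx_maximalRealSubfield_le_two L W
  have hposW : 0 < W.asIdeal.ramificationIdx (𝓞 M) := Ideal.ramificationIdx_pos _ _
  have hposv : 0 < v.asIdeal.ramificationIdx ℤ := by haveI := v.isPrime; exact Ideal.ramificationIdx_pos _ _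
  have hposw : 0 < w.asIdeal.ramificationIdx (𝓞 ↥(maximalRealSubfield M)) := Ideal.ramificationIdx_pos _ _
  rw [he𝔮, one_mul] at h1
  -- arithmetic: `a = e(W|L⁺) ≤ 2`, `a = x·b·c` with `b = e(w|M⁺) ≥ 2`, `c = e(W|w) ≥ 1`, `x ≥ 1`
  set a := W.asIdeal.ramificationIdx (𝓞 ↥(maximalRealSubfield L))
  set b := w.asIdeal.ramificationIdx (𝓞 ↥(maximalRealSubfield M))
  set c := W.asIdeal.ramificationIdx (𝓞 M)
  set x := v.asIdeal.ramificationIdx ℤ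
  have hb2 : 2 ≤ b := by omega
  have habc : a = x * b * c := by rw [← h1, h2, h3]
  have hc1 : c = 1 := by
    by_contra hc
    have hc2 : 2 ≤ c := by omega
    have : 4 ≤ a := by
      rw [habc]
      calc 4 = 1 * 2 * 2 := by norm_num
        _ ≤ x * b * c := Nat.mul_le_mul (Nat.mul_le_mul hposv hb2) hc2
    omega
  refine ⟨hc1, ?_⟩
  rw [hc1, mul_one] at habc
  have : b ≤ a := by rw [habc]; exact Nat.le_mul_of_pos_left b hposv
  omega

end Ram

/-! ## §2 The capitulation kernel and the dyadic class for the pair `X_{n+1} ⊆ X_{n+2}` -/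

section Pair

variable {κ : ZpExtension ℚ 2} (hκ : κ.IsCyclotomic) (K : Type) [Field K] [NumberField K] (j : K →ₐ[ℚ] AlgebraicClosure ℚ)

set_option maxHeartbeats 400000 in
include hκ in
/-- **Capitulation in `X_{n+1} ⊆ X_{n+2}`, generic embedding `j`.**  `K ∋ √−d` (`[K : ℚ] = 2`, `d ≡ 1 (mod 4)` squarefree, `d ≠ 1`), `M = j(K)·ℚ_{n+1}`, `L = j(K)·ℚ_{n+2}`;
HYPOTHESES: (W) the roots of unity of every `j(K)·ℚ_m` lie in `j(K)`; (D) every `j(K)·ℚ_m` has a unique prime containing `2`, of ramification index `2^{m+1}` over `2`.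
THEN for the primes `𝔓_M ∋ 2`, `𝔓_L ∋ 2`: **(i)** every capitulating class is `1` or `[𝔓_M]`; **(ii)** `[𝔓_L]` is not in the image of `Cl(M) → Cl(L)`; **(iii)** `[𝔓_M]` capitulates.
((T) from (W), (NPI), (ODD) = `h(ℚ_{n+1})` odd, (RAM′) off `𝔓_M`, `e(𝔓_M ∣ M⁺) = e(𝔓_L ∣ 𝔓_M) = e(𝔓_L ∣ L⁺) = 2`, `[𝔓_M]² = 1`, and the abstract `CMLayer` theorems.)
[cite: Ferrero1980AJM, §3] [cite: Kida1979Tohoku, Thm. 1 (proof)] [cite: Schettler2014, Thm. 8] [cite: Washington1997, Prop. 13.26] -/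
theorem dyadicCapitulation_fieldRange_sup_layer_of (hK2 : Module.finrank ℚ K = 2) {d : ℕ} (hsf : Squarefree d) (hd4 : d % 4 = 1) (hd1 : d ≠ 1)
    (hη : ∃ η : K, η ^ 2 = -((d : ℕ) : K))
    (hW : ∀ (m : ℕ) (x : ↥(j.fieldRange ⊔ κ.layer m)), (∃ k : ℕ, 0 < k ∧ x ^ k = 1) → (x : AlgebraicClosure ℚ) ∈ j.fieldRange)
    (hdy : ∀ m : ℕ, haveI : NumberField ↥(j.fieldRange ⊔ κ.layer m) := numberField_fieldRange_sup_layer κ K j m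
      ∃ 𝔓 : HeightOneSpectrum (𝓞 ↥(j.fieldRange ⊔ κ.layer m)), (2 : 𝓞 ↥(j.fieldRange ⊔ κ.layer m)) ∈ 𝔓.asIdeal ∧
        𝔓.asIdeal.ramificationIdx ℤ = 2 ^ (m + 1) ∧ ∀ Q : HeightOneSpectrum (𝓞 ↥(j.fieldRange ⊔ κ.layer m)), (2 : 𝓞 ↥(j.fieldRange ⊔ κ.layer m)) ∈ Q.asIdeal → Q = 𝔓)
    (n : ℕ) :
    haveI : NumberField ↥(j.fieldRange ⊔ κ.layer (n + 1)) := numberField_fieldRange_sup_layer κ K j (n + 1)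
    haveI : NumberField ↥(j.fieldRange ⊔ κ.layer (n + 2)) := numberField_fieldRange_sup_layer κ K j (n + 2)
    letI : Algebra ↥(j.fieldRange ⊔ κ.layer (n + 1)) ↥(j.fieldRange ⊔ κ.layer (n + 2)) :=
      (IntermediateField.inclusion (sup_le_sup_left (κ.layer_mono (by omega)) _)).toRingHom.toAlgebra
    ∀ (𝔓M : HeightOneSpectrum (𝓞 ↥(j.fieldRange ⊔ κ.layer (n + 1)))), (2 : 𝓞 ↥(j.fieldRange ⊔ κ.layer (n + 1))) ∈ 𝔓M.asIdeal →
    ∀ (𝔓L : HeightOneSpectrum (𝓞 ↥(j.fieldRange ⊔ κ.layer (n + 2)))), (2 : 𝓞 ↥(j.fieldRange ⊔ κ.layer (n + 2))) ∈ 𝔓L.asIdeal →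
      (∀ c : ClassGroup (𝓞 ↥(j.fieldRange ⊔ κ.layer (n + 1))),
          classGroupExtend ↥(j.fieldRange ⊔ κ.layer (n + 1)) ↥(j.fieldRange ⊔ κ.layer (n + 2)) c = 1 →
            c = 1 ∨ c = ClassGroup.mk0 ⟨𝔓M.asIdeal, mem_nonZeroDivisors_of_ne_zero 𝔓M.ne_bot⟩) ∧
        ClassGroup.mk0 ⟨𝔓L.asIdeal, mem_nonZeroDivisors_of_ne_zero 𝔓L.ne_bot⟩ ∉
          (classGroupExtend ↥(j.fieldRange ⊔ κ.layer (n + 1)) ↥(j.fieldRange ⊔ κ.layer (n + 2))).range ∧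
        classGroupExtend ↥(j.fieldRange ⊔ κ.layer (n + 1)) ↥(j.fieldRange ⊔ κ.layer (n + 2))
            (ClassGroup.mk0 ⟨𝔓M.asIdeal, mem_nonZeroDivisors_of_ne_zero 𝔓M.ne_bot⟩) = 1 := by
  classical
  haveI : NumberField ↥(j.fieldRange ⊔ κ.layer (n + 1)) := numberField_fieldRange_sup_layer κ K j (n + 1)
  haveI : NumberField ↥(j.fieldRange ⊔ κ.layer (n + 2)) := numberField_fieldRange_sup_layer κ K j (n + 2)
  have hML : j.fieldRange ⊔ κ.layer (n + 1) ≤ j.fieldRange ⊔ κ.layer (n + 2) := sup_le_sup_left (κ.layer_mono (by omega)) _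
  letI : Algebra ↥(j.fieldRange ⊔ κ.layer (n + 1)) ↥(j.fieldRange ⊔ κ.layer (n + 2)) := (IntermediateField.inclusion hML).toRingHom.toAlgebra
  intro 𝔓M h2M 𝔓L h2L
  have hd5 : 0 < d := by omega
  have hIQ := isImaginaryQuadratic_of_sq_eq_neg K hK2 hd5 hη
  obtain ⟨hCMM, hdegM, hrestM⟩ := isCMField_fieldRange_sup_layer hκ K hIQ j (n + 1)
  obtain ⟨hCML, hdegL, hrestL⟩ := isCMField_fieldRange_sup_layer hκ K hIQ j (n + 2)
  haveI := hCMM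
  haveI := hCML
  obtain ⟨hoddM, -, -, -⟩ := hrestM
  obtain ⟨hoddL, -, -, -⟩ := hrestL
  have h2 : Module.finrank ↥(j.fieldRange ⊔ κ.layer (n + 1)) ↥(j.fieldRange ⊔ κ.layer (n + 2)) = 2 := by
    have h := finrank_inclusion_mul_finrank (j.fieldRange ⊔ κ.layer (n + 1)) (j.fieldRange ⊔ κ.layer (n + 2)) hML
    rw [hdegM, hdegL] at h
    have h' : 2 ^ (n + 2) * 2 = 2 * (2 ^ (n + 1) * 2) := by ring
    rw [h'] at h
    have hpos : 0 < 2 ^ (n + 1) * 2 := by positivity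
    exact Nat.eq_of_mul_eq_mul_right hpos h
  -- the dyadic primes
  obtain ⟨𝔓M', h2M', heM', huniqM⟩ := hdy (n + 1)
  obtain ⟨𝔓L', h2L', heL', huniqL⟩ := hdy (n + 2)
  have hM' : 𝔓M = 𝔓M' := huniqM 𝔓M h2M
  have hL' : 𝔓L = 𝔓L' := huniqL 𝔓L h2L
  subst hM' hL'
  obtain ⟨heMp, hsqM⟩ := @dyadic_of_isCMField ↥(j.fieldRange ⊔ κ.layer (n + 1)) _ _ _ hoddM (n + 1) hdegM 𝔓M h2M heM' huniqM
  obtain ⟨heLp, hsqL⟩ := @dyadic_of_isCMField ↥(j.fieldRange ⊔ κ.layer (n + 2)) _ _ _ hoddL (n + 2) hdegL 𝔓L h2L heL' huniqL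
  -- `𝔓_L` lies over `𝔓_M`, `e(𝔓_L ∣ 𝔓_M) = 2`
  haveI := 𝔓M.isPrime
  haveI := 𝔓L.isPrime
  haveI : (Ideal.span {(2 : ℤ)}).IsMaximal := ((Ideal.span_singleton_prime two_ne_zero).mpr Int.prime_two).isMaximal (by simp)
  have hunderLM : 𝔓L.under (𝓞 ↥(j.fieldRange ⊔ κ.layer (n + 1))) = 𝔓M := by
    apply huniqM
    rw [HeightOneSpectrum.under_asIdeal, Ideal.under_def, Ideal.mem_comap, map_ofNat]
    exact h2L
  haveI hLM : 𝔓L.asIdeal.LiesOver 𝔓M.asIdeal := ⟨congrArg HeightOneSpectrum.asIdeal hunderLM.symm⟩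
  haveI hM2 : 𝔓M.asIdeal.LiesOver (Ideal.span {(2 : ℤ)}) := by
    rw [Ideal.liesOver_span_iff 𝔓M.isPrime.ne_top Int.prime_two, map_ofNat]; exact h2M
  have heLM : 𝔓L.asIdeal.ramificationIdx (𝓞 ↥(j.fieldRange ⊔ κ.layer (n + 1))) = 2 := by
    have htower : 𝔓L.asIdeal.ramificationIdx ℤ = 𝔓M.asIdeal.ramificationIdx ℤ * 𝔓L.asIdeal.ramificationIdx (𝓞 ↥(j.fieldRange ⊔ κ.layer (n + 1))) :=
      Ideal.ramificationIdx_tower (R := ℤ) (S := 𝓞 ↥(j.fieldRange ⊔ κ.layer (n + 1))) (T := 𝓞 ↥(j.fieldRange ⊔ κ.layer (n + 2))) (q := 𝔓M.asIdeal) (r := 𝔓L.asIdeal)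
    rw [heL', heM', pow_succ] at htower
    exact (Nat.eq_of_mul_eq_mul_left (by positivity) htower).symm
  -- (T), (NPI), (RAM′)
  have hT : ∀ (σ : ↥(j.fieldRange ⊔ κ.layer (n + 2)) ≃ₐ[↥(j.fieldRange ⊔ κ.layer (n + 1))] ↥(j.fieldRange ⊔ κ.layer (n + 2))) (x : ↥(j.fieldRange ⊔ κ.layer (n + 2))) (k : ℕ), 0 < k → x ^ k = 1 → σ x = x := by
    intro σ x k hk hxk
    have hxK := hW (n + 2) x ⟨k, hk, hxk⟩
    have hxM : (x : AlgebraicClosure ℚ) ∈ j.fieldRange ⊔ κ.layer (n + 1) := (le_sup_left : j.fieldRange ≤ _) hxK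
    have : x = algebraMap ↥(j.fieldRange ⊔ κ.layer (n + 1)) ↥(j.fieldRange ⊔ κ.layer (n + 2)) ⟨(x : AlgebraicClosure ℚ), hxM⟩ := Subtype.ext rfl
    rw [this, AlgEquiv.commutes]
  have hi := sq_ne_neg_one_of_sq_eq_neg_of_ne_one K hK2 hsf hd1 hη
  have hNPI := complexConj_unit_ne_neg_fieldRange_sup_layer hκ K hIQ j (n + 2) hi (hW (n + 2))
  have hram := ram_fieldRange_sup_layer_pair_of_ne hκ K hIQ j n 𝔓M huniqM
  refine ⟨fun c hc => eq_one_or_eq_mk0_of_classGroupExtend_eq_one ↥(j.fieldRange ⊔ κ.layer (n + 1)) ↥(j.fieldRange ⊔ κ.layer (n + 2)) h2 hoddM hT hNPI 𝔓M heMp hsqM hram hc,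
    mk0_not_mem_range_classGroupExtend ↥(j.fieldRange ⊔ κ.layer (n + 1)) ↥(j.fieldRange ⊔ κ.layer (n + 2)) h2 hT hNPI 𝔓L heLM heLp, ?_⟩
  -- (iii) `𝔓_M 𝓞_L = 𝔓_L²`
  have hprimes : 𝔓M.asIdeal.primesOver (𝓞 ↥(j.fieldRange ⊔ κ.layer (n + 2))) = {𝔓L.asIdeal} := by
    ext Q
    simp only [Set.mem_singleton_iff]
    constructor
    · rintro ⟨hQp, hQover⟩
      have hQ0 : Q ≠ ⊥ := Ideal.ne_bot_of_liesOver_of_ne_bot 𝔓M.ne_bot Q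
      have h2Q : (2 : 𝓞 ↥(j.fieldRange ⊔ κ.layer (n + 2))) ∈ (⟨Q, hQp, hQ0⟩ : HeightOneSpectrum (𝓞 ↥(j.fieldRange ⊔ κ.layer (n + 2)))).asIdeal := by
        have : algebraMap (𝓞 ↥(j.fieldRange ⊔ κ.layer (n + 1))) (𝓞 ↥(j.fieldRange ⊔ κ.layer (n + 2))) 2 ∈ Q := by
          rw [← Ideal.mem_comap, ← Ideal.under_def, ← hQover.over]; exact h2M
        rwa [map_ofNat] at this
      exact congrArg HeightOneSpectrum.asIdeal (huniqL _ h2Q)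
    · rintro rfl
      exact ⟨𝔓L.isPrime, hLM⟩
  haveI := 𝔓M.isMaximal
  have hmap : 𝔓M.asIdeal.map (algebraMap (𝓞 ↥(j.fieldRange ⊔ κ.layer (n + 1))) (𝓞 ↥(j.fieldRange ⊔ κ.layer (n + 2)))) = 𝔓L.asIdeal ^ 2 := by
    rw [Ideal.map_algebraMap_eq_finsetProd_pow (R := 𝓞 ↥(j.fieldRange ⊔ κ.layer (n + 2))) 𝔓M.ne_bot]
    simp only [hprimes, Set.toFinset_singleton, Finset.prod_singleton, heLM]
  -- `mk0 (𝔓_M 𝓞_L) = mk0 (𝔓_L²) = [𝔓_L]² = 1`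
  have hkey : ∀ (I : (Ideal (𝓞 ↥(j.fieldRange ⊔ κ.layer (n + 2))))⁰), (I : Ideal (𝓞 ↥(j.fieldRange ⊔ κ.layer (n + 2)))) = 𝔓L.asIdeal ^ 2 → ClassGroup.mk0 I = 1 := by
    intro I hI
    have hI' : I = ⟨𝔓L.asIdeal, mem_nonZeroDivisors_of_ne_zero 𝔓L.ne_bot⟩ ^ 2 := Subtype.ext (by rw [SubmonoidClass.mk_pow]; exact hI)
    rw [hI', map_pow, hsqL]
  rw [classGroupExtend_mk0]
  exact hkey _ hmap

include hκ in
/-- ★ **Capitulation in `X_{n+1} ⊆ X_{n+2}` for `K ∋ √−d`, `d ≡ 1 (mod 4)` squarefree, `d ≠ 1`, `X_m = e(K)·ℚ_m` with `e = absEmbedding ℚ K`** ((W) and the dyadic primes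
are tree theorems there: `rootsOfUnity_mem_fieldRange_of_mod_four_eq_one`, `exists_dyadic_prime_fieldRange_sup_layer`): for the primes `𝔓_M ∋ 2` of `M = X_{n+1}` and
`𝔓_L ∋ 2` of `L = X_{n+2}`, **(i)** every capitulating class is `1` or `[𝔓_M]`; **(ii)** `[𝔓_L] ∉ i_{L/M}(Cl(M))`; **(iii)** `i_{L/M}[𝔓_M] = 1`.
[cite: Ferrero1980AJM, §3] [cite: Kida1979Tohoku, Thm. 1 (proof)] [cite: Washington1997, Prop. 13.26] -/
theorem dyadicCapitulation_fieldRange_sup_layer (hK2 : Module.finrank ℚ K = 2) {d : ℕ} (hsf : Squarefree d) (hd4 : d % 4 = 1) (hd1 : d ≠ 1)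
    (hη : ∃ η : K, η ^ 2 = -((d : ℕ) : K)) (n : ℕ) :
    haveI : NumberField ↥((absEmbedding ℚ K).fieldRange ⊔ κ.layer (n + 1)) := numberField_fieldRange_sup_layer κ K (absEmbedding ℚ K) (n + 1)
    haveI : NumberField ↥((absEmbedding ℚ K).fieldRange ⊔ κ.layer (n + 2)) := numberField_fieldRange_sup_layer κ K (absEmbedding ℚ K) (n + 2)
    letI : Algebra ↥((absEmbedding ℚ K).fieldRange ⊔ κ.layer (n + 1)) ↥((absEmbedding ℚ K).fieldRange ⊔ κ.layer (n + 2)) :=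
      (IntermediateField.inclusion (sup_le_sup_left (κ.layer_mono (by omega)) _)).toRingHom.toAlgebra
    ∀ (𝔓M : HeightOneSpectrum (𝓞 ↥((absEmbedding ℚ K).fieldRange ⊔ κ.layer (n + 1)))),
      (2 : 𝓞 ↥((absEmbedding ℚ K).fieldRange ⊔ κ.layer (n + 1))) ∈ 𝔓M.asIdeal →
    ∀ (𝔓L : HeightOneSpectrum (𝓞 ↥((absEmbedding ℚ K).fieldRange ⊔ κ.layer (n + 2)))),
      (2 : 𝓞 ↥((absEmbedding ℚ K).fieldRange ⊔ κ.layer (n + 2))) ∈ 𝔓L.asIdeal →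
      (∀ c : ClassGroup (𝓞 ↥((absEmbedding ℚ K).fieldRange ⊔ κ.layer (n + 1))),
          classGroupExtend ↥((absEmbedding ℚ K).fieldRange ⊔ κ.layer (n + 1)) ↥((absEmbedding ℚ K).fieldRange ⊔ κ.layer (n + 2)) c = 1 →
            c = 1 ∨ c = ClassGroup.mk0 ⟨𝔓M.asIdeal, mem_nonZeroDivisors_of_ne_zero 𝔓M.ne_bot⟩) ∧
        ClassGroup.mk0 ⟨𝔓L.asIdeal, mem_nonZeroDivisors_of_ne_zero 𝔓L.ne_bot⟩ ∉
          (classGroupExtend ↥((absEmbedding ℚ K).fieldRange ⊔ κ.layer (n + 1)) ↥((absEmbedding ℚ K).fieldRange ⊔ κ.layer (n + 2))).range ∧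
        classGroupExtend ↥((absEmbedding ℚ K).fieldRange ⊔ κ.layer (n + 1)) ↥((absEmbedding ℚ K).fieldRange ⊔ κ.layer (n + 2))
            (ClassGroup.mk0 ⟨𝔓M.asIdeal, mem_nonZeroDivisors_of_ne_zero 𝔓M.ne_bot⟩) = 1 :=
  dyadicCapitulation_fieldRange_sup_layer_of hκ K (absEmbedding ℚ K) hK2 hsf hd4 hd1 hη
    (fun m x hx => rootsOfUnity_mem_fieldRange_of_mod_four_eq_one hκ K hK2 hsf hd4 hd1 hη m x hx)
    (fun m => exists_dyadic_prime_fieldRange_sup_layer hκ K hK2 hd4 hη m) n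

end Pair

end Literature.NumberTheory.IwasawaTheory

end
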